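import Mathlib.Algebra.BigOperators.Ring.Finset
import Mathlib.Algebra.Order.BigOperators.Ring.Finset
import Mathlib.Analysis.SpecialFunctions.Pow.Real
import HarnessLib

/-!
# Crux `PercNonProliferation.FreeBoxSparse` (stmt-CriticalPhenomena-4445), line `ccfs-window-kissing-walls` —
# helper for stub `stub_collar`, part 1: the abstract `χ²` / total-variation window

Helper file for the lead's skeleton of line `ccfs-window-kissing-walls`
(prover-line-stmt-CriticalPhenomena-4445-0); lands with `--supports stmt-CriticalPhenomena-4445`.
Pure finite algebra, no percolation.

Setting: a finite set `K` of coordinates (edges), the product Bernoulli(`p`) weight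
`pw_K(κ) = p^{|κ|} (1-p)^{|K|-|κ|}` on `K.powerset`, a finite family of pairwise disjoint blocks
`U k ⊆ K`, `k ∈ I`, and the *template sprinkling* of density `s`: open every block independently with
probability `s`, i.e. replace `κ` by `κ ∪ ⋃_{k ∈ J} U k` with `J ∼ Bernoulli(s)^{⊗ I}`. Its law has
density `g(κ) = ∏_{k ∈ I} (1 - s + s p^{-|U k|} 1{U k ⊆ κ})` with respect to `pw_K`
(`sum_pw_density_mul`), `E[g] = 1` (`sum_pw_density`), and
`E[g²] = ∏_{k ∈ I} (1 + s² (p^{-|U k|} - 1))` (`sum_pw_density_sq`, the `χ²`-tensorisation).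
Cauchy–Schwarz then gives the Chayes–Chayes–Fisher–Spencer / Aizenman–Kesten–Newman window
`tv_window`: for every test function `|F| ≤ 1`,
`|E_p[F] - E_{sprinkled}[F]| ≤ √(∏_{k∈I} (1 + s²(p^{-|U k|} - 1)) - 1)`, which is `O(s √|I|)` for
blocks of bounded size — the finite product law cannot distinguish a perturbation of `ℓ²`-size `o(1)`.
-/

noncomputable section

namespace Summit.CriticalPhenomena.PercolationContinuityZ3.Theorems.FreeBoxSparse

namespace StubCollar

open Finset

variable {α β : Type*} [DecidableEq α] [DecidableEq β]

omit [DecidableEq α] in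
/-- Binomial identity: the Bernoulli weights on the power set sum to `1`. [folklore] -/
theorem sum_pw_eq_one (K : Finset α) (p : ℝ) :
    ∑ κ ∈ K.powerset, p ^ κ.card * (1 - p) ^ (K.card - κ.card) = 1 := by
  rw [Finset.sum_pow_mul_eq_add_pow]; simp

/-- The power set of a disjoint union: summing over `(A ∪ B).powerset` is summing over pairs.
[folklore] -/
theorem sum_powerset_union {M : Type*} [AddCommMonoid M] {A B : Finset α} (h : Disjoint A B)
    (f : Finset α → M) :
    ∑ κ ∈ (A ∪ B).powerset, f κ = ∑ a ∈ A.powerset, ∑ b ∈ B.powerset, f (a ∪ b) := by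
  rw [← Finset.sum_product']
  refine Finset.sum_nbij' (fun κ => (κ ∩ A, κ ∩ B)) (fun ab => ab.1 ∪ ab.2) ?_ ?_ ?_ ?_ ?_
  · intro κ hκ
    simp only [Finset.mem_powerset] at hκ
    simp only [Finset.mem_product, Finset.mem_powerset]
    exact ⟨Finset.inter_subset_right, Finset.inter_subset_right⟩
  · intro ab hab
    simp only [Finset.mem_product, Finset.mem_powerset] at hab
    simp only [Finset.mem_powerset]
    exact Finset.union_subset_union hab.1 hab.2
  · intro κ hκ
    simp only [Finset.mem_powerset] at hκ
    change κ ∩ A ∪ κ ∩ B = κ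
    rw [← Finset.inter_union_distrib_left, Finset.inter_eq_left.2 hκ]
  · intro ab hab
    simp only [Finset.mem_product, Finset.mem_powerset] at hab
    have hbA : ab.2 ∩ A = ∅ :=
      Finset.disjoint_iff_inter_eq_empty.1 (Finset.disjoint_of_subset_left hab.2 h.symm)
    have haB : ab.1 ∩ B = ∅ :=
      Finset.disjoint_iff_inter_eq_empty.1 (Finset.disjoint_of_subset_left hab.1 h)
    change ((ab.1 ∪ ab.2) ∩ A, (ab.1 ∪ ab.2) ∩ B) = ab
    ext1
    · change (ab.1 ∪ ab.2) ∩ A = ab.1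
      rw [Finset.union_inter_distrib_right, hbA, Finset.union_empty, Finset.inter_eq_left.2 hab.1]
    · change (ab.1 ∪ ab.2) ∩ B = ab.2
      rw [Finset.union_inter_distrib_right, haB, Finset.empty_union, Finset.inter_eq_left.2 hab.2]
  · intro κ hκ
    simp only [Finset.mem_powerset] at hκ
    change f κ = f (κ ∩ A ∪ κ ∩ B)
    rw [← Finset.inter_union_distrib_left, Finset.inter_eq_left.2 hκ]

/-- **Absorption.** Forcing the coordinates of `D ⊆ K` open and testing `F`: the `D`-coordinates
integrate out. [folklore] -/
theorem sum_pw_mul_apply_union (K D : Finset α) (hD : D ⊆ K) (p : ℝ) (F : Finset α → ℝ) :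
    ∑ κ ∈ K.powerset, p ^ κ.card * (1 - p) ^ (K.card - κ.card) * F (κ ∪ D) =
      ∑ κ ∈ (K \ D).powerset, p ^ κ.card * (1 - p) ^ ((K \ D).card - κ.card) * F (κ ∪ D) := by
  have hK : K = (K \ D) ∪ D := (Finset.sdiff_union_of_subset hD).symm
  conv_lhs => rw [hK]
  rw [sum_powerset_union Finset.sdiff_disjoint]
  refine Finset.sum_congr rfl fun a ha => ?_
  rw [Finset.mem_powerset] at ha
  have haD : Disjoint a D := Finset.disjoint_of_subset_left ha Finset.sdiff_disjoint
  have hcardK : ((K \ D) ∪ D).card = (K \ D).card + D.card :=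
    Finset.card_union_of_disjoint Finset.sdiff_disjoint
  calc ∑ b ∈ D.powerset, p ^ (a ∪ b).card * (1 - p) ^ (((K \ D) ∪ D).card - (a ∪ b).card) *
          F (a ∪ b ∪ D)
      = ∑ b ∈ D.powerset, (p ^ b.card * (1 - p) ^ (D.card - b.card)) *
          (p ^ a.card * (1 - p) ^ ((K \ D).card - a.card) * F (a ∪ D)) := by
        refine Finset.sum_congr rfl fun b hb => ?_
        rw [Finset.mem_powerset] at hb
        have hab : Disjoint a b := haD.mono_right hb
        have h1 : (a ∪ b).card = a.card + b.card := Finset.card_union_of_disjoint hab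
        have h2 : a ∪ b ∪ D = a ∪ D := by rw [Finset.union_assoc, Finset.union_eq_right.2 hb]
        have h3 : a.card ≤ (K \ D).card := Finset.card_le_card ha
        have h4 : b.card ≤ D.card := Finset.card_le_card hb
        rw [h1, h2, hcardK]
        have h5 : (K \ D).card + D.card - (a.card + b.card) =
            ((K \ D).card - a.card) + (D.card - b.card) := by omega
        rw [h5, pow_add, pow_add]; ring
    _ = p ^ a.card * (1 - p) ^ ((K \ D).card - a.card) * F (a ∪ D) := by
        rw [← Finset.sum_mul, sum_pw_eq_one, one_mul]

/-- **Conditioning on a cylinder.** Testing `F` on `{D open}` costs the factor `p^{|D|}` and forces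
`D`. [folklore] -/
theorem sum_pw_ite_subset (K D : Finset α) (hD : D ⊆ K) (p : ℝ) (F : Finset α → ℝ) :
    ∑ κ ∈ K.powerset, p ^ κ.card * (1 - p) ^ (K.card - κ.card) * (if D ⊆ κ then F κ else 0) =
      p ^ D.card * ∑ κ ∈ (K \ D).powerset,
        p ^ κ.card * (1 - p) ^ ((K \ D).card - κ.card) * F (κ ∪ D) := by
  have hK : K = (K \ D) ∪ D := (Finset.sdiff_union_of_subset hD).symm
  conv_lhs => rw [hK]
  rw [sum_powerset_union Finset.sdiff_disjoint, Finset.mul_sum]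
  refine Finset.sum_congr rfl fun a ha => ?_
  rw [Finset.mem_powerset] at ha
  have haD : Disjoint a D := Finset.disjoint_of_subset_left ha Finset.sdiff_disjoint
  have hcardK : ((K \ D) ∪ D).card = (K \ D).card + D.card :=
    Finset.card_union_of_disjoint Finset.sdiff_disjoint
  rw [Finset.sum_eq_single_of_mem D (Finset.mem_powerset.2 subset_rfl)]
  · have h1 : (a ∪ D).card = a.card + D.card := Finset.card_union_of_disjoint haD
    rw [if_pos Finset.subset_union_right, h1, hcardK]
    have h5 : (K \ D).card + D.card - (a.card + D.card) = (K \ D).card - a.card := by omega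
    rw [h5, pow_add]; ring
  · intro b hb hbD
    rw [Finset.mem_powerset] at hb
    have hnot : ¬ D ⊆ a ∪ b := by
      intro h
      apply hbD
      refine Finset.Subset.antisymm hb fun x hx => ?_
      rcases Finset.mem_union.1 (h hx) with h' | h'
      · exact ((Finset.disjoint_left.1 haD h') hx).elim
      · exact h'
    rw [if_neg hnot, mul_zero]

/-- `E_p[1{D open} F] = p^{|D|} E_p[F(· ∪ D)]`. [folklore] -/
theorem sum_pw_ite_subset_eq (K D : Finset α) (hD : D ⊆ K) (p : ℝ) (F : Finset α → ℝ) :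
    ∑ κ ∈ K.powerset, p ^ κ.card * (1 - p) ^ (K.card - κ.card) * (if D ⊆ κ then F κ else 0) =
      p ^ D.card * ∑ κ ∈ K.powerset, p ^ κ.card * (1 - p) ^ (K.card - κ.card) * F (κ ∪ D) := by
  rw [sum_pw_ite_subset K D hD, sum_pw_mul_apply_union K D hD]

/-- The cylinder probability `P_p(D open) = p^{|D|}`. [folklore] -/
theorem sum_pw_ite_subset_one (K D : Finset α) (hD : D ⊆ K) (p : ℝ) :
    ∑ κ ∈ K.powerset, p ^ κ.card * (1 - p) ^ (K.card - κ.card) * (if D ⊆ κ then (1 : ℝ) else 0) =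
      p ^ D.card := by
  rw [sum_pw_ite_subset_eq K D hD p (fun _ => (1 : ℝ))]
  simp only [mul_one]
  rw [sum_pw_eq_one, mul_one]

/-- **The sprinkling density, expanded**: `∏_{k∈I} (s p^{-|U k|} 1{U k ⊆ κ} + (1-s))
= Σ_{J ⊆ I} s^{|J|} (1-s)^{|I|-|J|} p^{-|U_J|} 1{U_J ⊆ κ}`, `U_J = ⋃_{k∈J} U k`. [folklore] -/
theorem density_expand (I : Finset β) (U : β → Finset α) (hU : (I : Set β).PairwiseDisjoint U)
    (p s : ℝ) (κ : Finset α) :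
    ∏ k ∈ I, (s * (p ^ (U k).card)⁻¹ * (if U k ⊆ κ then (1 : ℝ) else 0) + (1 - s)) =
      ∑ J ∈ I.powerset, s ^ J.card * (1 - s) ^ (I.card - J.card) *
        ((p ^ (J.biUnion U).card)⁻¹ * (if J.biUnion U ⊆ κ then (1 : ℝ) else 0)) := by
  rw [Finset.prod_add]
  refine Finset.sum_congr rfl fun J hJ => ?_
  rw [Finset.mem_powerset] at hJ
  have hdisj : (J : Set β).PairwiseDisjoint U := hU.subset (Finset.coe_subset.2 hJ)
  rw [Finset.prod_mul_distrib, Finset.prod_mul_distrib, Finset.prod_const, Finset.prod_const,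
    Finset.card_sdiff_of_subset hJ, Finset.prod_boole, Finset.prod_inv_distrib,
    Finset.prod_pow_eq_pow_sum, ← Finset.card_biUnion hdisj]
  by_cases h : J.biUnion U ⊆ κ
  · have h' : ∀ k ∈ J, U k ⊆ κ := Finset.biUnion_subset.1 h
    rw [if_pos h, if_pos h']; ring
  · have h' : ¬ ∀ k ∈ J, U k ⊆ κ := fun h' => h (Finset.biUnion_subset.2 h')
    rw [if_neg h, if_neg h']; ring

/-- **The sprinkled law is the `g`-tilt of `P_p`**: `E_p[g F] = Σ_J s^{|J|}(1-s)^{|I|-|J|} E_p[F(· ∪ U_J)]`.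
[folklore] -/
theorem sum_pw_density_mul (K : Finset α) (I : Finset β) (U : β → Finset α)
    (hU : (I : Set β).PairwiseDisjoint U) (hUK : ∀ k ∈ I, U k ⊆ K) (p : ℝ) (hp : p ≠ 0) (s : ℝ)
    (F : Finset α → ℝ) :
    ∑ κ ∈ K.powerset, p ^ κ.card * (1 - p) ^ (K.card - κ.card) *
        ((∏ k ∈ I, (s * (p ^ (U k).card)⁻¹ * (if U k ⊆ κ then (1 : ℝ) else 0) + (1 - s))) * F κ) =
      ∑ J ∈ I.powerset, s ^ J.card * (1 - s) ^ (I.card - J.card) *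
        ∑ κ ∈ K.powerset, p ^ κ.card * (1 - p) ^ (K.card - κ.card) * F (κ ∪ J.biUnion U) := by
  simp only [density_expand I U hU p s]
  calc ∑ κ ∈ K.powerset, p ^ κ.card * (1 - p) ^ (K.card - κ.card) *
          ((∑ J ∈ I.powerset, s ^ J.card * (1 - s) ^ (I.card - J.card) *
            ((p ^ (J.biUnion U).card)⁻¹ * (if J.biUnion U ⊆ κ then (1 : ℝ) else 0))) * F κ)
      = ∑ κ ∈ K.powerset, ∑ J ∈ I.powerset, s ^ J.card * (1 - s) ^ (I.card - J.card) *
          (p ^ (J.biUnion U).card)⁻¹ * (p ^ κ.card * (1 - p) ^ (K.card - κ.card) *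
            (if J.biUnion U ⊆ κ then F κ else 0)) := by
        refine Finset.sum_congr rfl fun κ _ => ?_
        rw [Finset.sum_mul, Finset.mul_sum]
        refine Finset.sum_congr rfl fun J _ => ?_
        split_ifs <;> ring
    _ = ∑ J ∈ I.powerset, s ^ J.card * (1 - s) ^ (I.card - J.card) * (p ^ (J.biUnion U).card)⁻¹ *
          ∑ κ ∈ K.powerset, p ^ κ.card * (1 - p) ^ (K.card - κ.card) *
            (if J.biUnion U ⊆ κ then F κ else 0) := by
        rw [Finset.sum_comm]
        refine Finset.sum_congr rfl fun J _ => ?_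
        rw [Finset.mul_sum]
    _ = _ := by
        refine Finset.sum_congr rfl fun J hJ => ?_
        rw [Finset.mem_powerset] at hJ
        have hJK : J.biUnion U ⊆ K := Finset.biUnion_subset.2 fun k hk => hUK k (hJ hk)
        rw [sum_pw_ite_subset_eq K _ hJK p F]
        have hc : (p ^ (J.biUnion U).card)⁻¹ * p ^ (J.biUnion U).card = 1 :=
          inv_mul_cancel₀ (pow_ne_zero _ hp)
        calc s ^ J.card * (1 - s) ^ (I.card - J.card) * (p ^ (J.biUnion U).card)⁻¹ *
              (p ^ (J.biUnion U).card * ∑ κ ∈ K.powerset,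
                p ^ κ.card * (1 - p) ^ (K.card - κ.card) * F (κ ∪ J.biUnion U))
            = s ^ J.card * (1 - s) ^ (I.card - J.card) *
                ((p ^ (J.biUnion U).card)⁻¹ * p ^ (J.biUnion U).card) *
                ∑ κ ∈ K.powerset, p ^ κ.card * (1 - p) ^ (K.card - κ.card) * F (κ ∪ J.biUnion U) := by
              ring
          _ = _ := by rw [hc, mul_one]

/-- `E_p[g] = 1`: the sprinkled law is a probability. [folklore] -/
theorem sum_pw_density (K : Finset α) (I : Finset β) (U : β → Finset α)
    (hU : (I : Set β).PairwiseDisjoint U) (hUK : ∀ k ∈ I, U k ⊆ K) (p : ℝ) (hp : p ≠ 0) (s : ℝ) :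
    ∑ κ ∈ K.powerset, p ^ κ.card * (1 - p) ^ (K.card - κ.card) *
        (∏ k ∈ I, (s * (p ^ (U k).card)⁻¹ * (if U k ⊆ κ then (1 : ℝ) else 0) + (1 - s))) = 1 := by
  have h := sum_pw_density_mul K I U hU hUK p hp s (fun _ => (1 : ℝ))
  simp only [mul_one] at h
  rw [h]
  simp only [sum_pw_eq_one, mul_one]

/-- **`χ²`-tensorisation**: `E_p[g²] = ∏_{k∈I} (1 + s² (p^{-|U k|} - 1))`. [folklore] -/
theorem sum_pw_density_sq (K : Finset α) (I : Finset β) (U : β → Finset α)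
    (hU : (I : Set β).PairwiseDisjoint U) (hUK : ∀ k ∈ I, U k ⊆ K) (p : ℝ) (hp : p ≠ 0) (s : ℝ) :
    ∑ κ ∈ K.powerset, p ^ κ.card * (1 - p) ^ (K.card - κ.card) *
        (∏ k ∈ I, (s * (p ^ (U k).card)⁻¹ * (if U k ⊆ κ then (1 : ℝ) else 0) + (1 - s))) ^ 2 =
      ∏ k ∈ I, (1 + s ^ 2 * ((p ^ (U k).card)⁻¹ - 1)) := by
  have hsq : ∀ κ : Finset α,
      (∏ k ∈ I, (s * (p ^ (U k).card)⁻¹ * (if U k ⊆ κ then (1 : ℝ) else 0) + (1 - s))) ^ 2 =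
        ∏ k ∈ I, ((2 * (1 - s) * s * (p ^ (U k).card)⁻¹ + s ^ 2 * (p ^ (U k).card)⁻¹ ^ 2) *
          (if U k ⊆ κ then (1 : ℝ) else 0) + (1 - s) ^ 2) := by
    intro κ
    rw [← Finset.prod_pow]
    refine Finset.prod_congr rfl fun k _ => ?_
    split_ifs <;> ring
  simp only [hsq]
  conv_lhs => arg 2; ext κ; rw [Finset.prod_add, Finset.mul_sum]
  rw [Finset.sum_comm]
  have step : ∀ J ∈ I.powerset,
      ∑ κ ∈ K.powerset, p ^ κ.card * (1 - p) ^ (K.card - κ.card) *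
        ((∏ k ∈ J, (2 * (1 - s) * s * (p ^ (U k).card)⁻¹ + s ^ 2 * (p ^ (U k).card)⁻¹ ^ 2) *
          (if U k ⊆ κ then (1 : ℝ) else 0)) * ∏ k ∈ I \ J, (1 - s) ^ 2) =
        (∏ k ∈ J, (2 * (1 - s) * s * (p ^ (U k).card)⁻¹ + s ^ 2 * (p ^ (U k).card)⁻¹ ^ 2) *
          p ^ (U k).card) * ∏ k ∈ I \ J, (1 - s) ^ 2 := by
    intro J hJ
    rw [Finset.mem_powerset] at hJ
    have hdisj : (J : Set β).PairwiseDisjoint U := hU.subset (Finset.coe_subset.2 hJ)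
    have hJK : J.biUnion U ⊆ K := Finset.biUnion_subset.2 fun k hk => hUK k (hJ hk)
    have hind : ∀ κ : Finset α,
        (∏ k ∈ J, (2 * (1 - s) * s * (p ^ (U k).card)⁻¹ + s ^ 2 * (p ^ (U k).card)⁻¹ ^ 2) *
          (if U k ⊆ κ then (1 : ℝ) else 0)) =
          (∏ k ∈ J, (2 * (1 - s) * s * (p ^ (U k).card)⁻¹ + s ^ 2 * (p ^ (U k).card)⁻¹ ^ 2)) *
            (if J.biUnion U ⊆ κ then (1 : ℝ) else 0) := by
      intro κ
      rw [Finset.prod_mul_distrib, Finset.prod_boole]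
      by_cases h : J.biUnion U ⊆ κ
      · rw [if_pos h, if_pos (Finset.biUnion_subset.1 h)]
      · rw [if_neg h, if_neg fun h' => h (Finset.biUnion_subset.2 h')]
    simp only [hind]
    calc ∑ κ ∈ K.powerset, p ^ κ.card * (1 - p) ^ (K.card - κ.card) *
          ((∏ k ∈ J, (2 * (1 - s) * s * (p ^ (U k).card)⁻¹ + s ^ 2 * (p ^ (U k).card)⁻¹ ^ 2)) *
            (if J.biUnion U ⊆ κ then (1 : ℝ) else 0) * ∏ k ∈ I \ J, (1 - s) ^ 2)
        = ((∏ k ∈ J, (2 * (1 - s) * s * (p ^ (U k).card)⁻¹ + s ^ 2 * (p ^ (U k).card)⁻¹ ^ 2)) *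
            ∏ k ∈ I \ J, (1 - s) ^ 2) *
            ∑ κ ∈ K.powerset, p ^ κ.card * (1 - p) ^ (K.card - κ.card) *
              (if J.biUnion U ⊆ κ then (1 : ℝ) else 0) := by
          rw [Finset.mul_sum]
          refine Finset.sum_congr rfl fun κ _ => ?_
          ring
      _ = ((∏ k ∈ J, (2 * (1 - s) * s * (p ^ (U k).card)⁻¹ + s ^ 2 * (p ^ (U k).card)⁻¹ ^ 2)) *
            ∏ k ∈ I \ J, (1 - s) ^ 2) * ∏ k ∈ J, p ^ (U k).card := by
          rw [sum_pw_ite_subset_one K _ hJK p, Finset.card_biUnion hdisj,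
            ← Finset.prod_pow_eq_pow_sum]
      _ = _ := by rw [Finset.prod_mul_distrib]; ring
  rw [Finset.sum_congr rfl step, ← Finset.prod_add]
  refine Finset.prod_congr rfl fun k _ => ?_
  have hc : (p ^ (U k).card)⁻¹ * p ^ (U k).card = 1 := inv_mul_cancel₀ (pow_ne_zero _ hp)
  calc (2 * (1 - s) * s * (p ^ (U k).card)⁻¹ + s ^ 2 * (p ^ (U k).card)⁻¹ ^ 2) * p ^ (U k).card +
        (1 - s) ^ 2
      = (2 * (1 - s) * s + s ^ 2 * (p ^ (U k).card)⁻¹) * ((p ^ (U k).card)⁻¹ * p ^ (U k).card) +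
        (1 - s) ^ 2 := by ring
    _ = _ := by rw [hc]; ring

/-- **The CCFS / AKN window (abstract form).** For the product Bernoulli(`p`) weight on `K.powerset`,
pairwise disjoint blocks `U k ⊆ K` (`k ∈ I`) sprinkled open independently with probability `s`, and
any test function `|F| ≤ 1`:
`|E_p[F] − Σ_{J⊆I} s^{|J|}(1−s)^{|I|−|J|} E_p[F(· ∪ U_J)]| ≤ √(∏_{k∈I}(1 + s²(p^{−|U k|} − 1)) − 1)`
(Cauchy–Schwarz against the `χ²`-divergence of the sprinkled law, which tensorises).
[cite: ChayesEtAl1986, finite-size scaling window] -/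
theorem tv_window (K : Finset α) (I : Finset β) (U : β → Finset α)
    (hU : (I : Set β).PairwiseDisjoint U) (hUK : ∀ k ∈ I, U k ⊆ K) (p : ℝ) (hp0 : 0 < p)
    (hp1 : p ≤ 1) (s : ℝ) (F : Finset α → ℝ) (hF : ∀ κ, |F κ| ≤ 1) :
    |∑ κ ∈ K.powerset, p ^ κ.card * (1 - p) ^ (K.card - κ.card) * F κ -
        ∑ J ∈ I.powerset, s ^ J.card * (1 - s) ^ (I.card - J.card) *
          ∑ κ ∈ K.powerset, p ^ κ.card * (1 - p) ^ (K.card - κ.card) * F (κ ∪ J.biUnion U)| ≤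
      Real.sqrt (∏ k ∈ I, (1 + s ^ 2 * ((p ^ (U k).card)⁻¹ - 1)) - 1) := by
  set g : Finset α → ℝ := fun κ =>
    ∏ k ∈ I, (s * (p ^ (U k).card)⁻¹ * (if U k ⊆ κ then (1 : ℝ) else 0) + (1 - s)) with hg
  have h7 := sum_pw_density_mul K I U hU hUK p hp0.ne' s F
  have h8 := sum_pw_density K I U hU hUK p hp0.ne' s
  have h9 := sum_pw_density_sq K I U hU hUK p hp0.ne' s
  rw [← h7]
  have hpw : ∀ κ ∈ K.powerset, 0 ≤ p ^ κ.card * (1 - p) ^ (K.card - κ.card) := fun κ _ =>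
    mul_nonneg (pow_nonneg hp0.le _) (pow_nonneg (sub_nonneg.2 hp1) _)
  have h1 : |∑ κ ∈ K.powerset, p ^ κ.card * (1 - p) ^ (K.card - κ.card) * F κ -
        ∑ κ ∈ K.powerset, p ^ κ.card * (1 - p) ^ (K.card - κ.card) * (g κ * F κ)| ≤
      ∑ κ ∈ K.powerset, p ^ κ.card * (1 - p) ^ (K.card - κ.card) * |g κ - 1| := by
    rw [← Finset.sum_sub_distrib]
    refine (Finset.abs_sum_le_sum_abs _ _).trans (Finset.sum_le_sum fun κ hκ => ?_)
    rw [← mul_sub, abs_mul, abs_of_nonneg (hpw κ hκ)]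
    refine mul_le_mul_of_nonneg_left ?_ (hpw κ hκ)
    rw [show F κ - g κ * F κ = (1 - g κ) * F κ by ring, abs_mul, abs_sub_comm]
    calc |g κ - 1| * |F κ| ≤ |g κ - 1| * 1 := mul_le_mul_of_nonneg_left (hF κ) (abs_nonneg _)
      _ = |g κ - 1| := mul_one _
  have h2 : (∑ κ ∈ K.powerset, p ^ κ.card * (1 - p) ^ (K.card - κ.card) * |g κ - 1|) ^ 2 ≤
      ∏ k ∈ I, (1 + s ^ 2 * ((p ^ (U k).card)⁻¹ - 1)) - 1 := by
    have hcs := Finset.sum_sq_le_sum_mul_sum_of_sq_le_mul K.powerset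
      (r := fun κ => p ^ κ.card * (1 - p) ^ (K.card - κ.card) * |g κ - 1|)
      (f := fun κ => p ^ κ.card * (1 - p) ^ (K.card - κ.card))
      (g := fun κ => p ^ κ.card * (1 - p) ^ (K.card - κ.card) * (g κ - 1) ^ 2) hpw
      (fun κ hκ => mul_nonneg (hpw κ hκ) (sq_nonneg _))
      (fun κ _ => by rw [mul_pow, sq_abs]; exact le_of_eq (by ring))
    rw [sum_pw_eq_one, one_mul] at hcs
    have h8' : ∑ κ ∈ K.powerset, p ^ κ.card * (1 - p) ^ (K.card - κ.card) * g κ = 1 := h8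
    have h9' : ∑ κ ∈ K.powerset, p ^ κ.card * (1 - p) ^ (K.card - κ.card) * g κ ^ 2 =
        ∏ k ∈ I, (1 + s ^ 2 * ((p ^ (U k).card)⁻¹ - 1)) := h9
    have hvar : ∑ κ ∈ K.powerset, p ^ κ.card * (1 - p) ^ (K.card - κ.card) * (g κ - 1) ^ 2 =
        ∏ k ∈ I, (1 + s ^ 2 * ((p ^ (U k).card)⁻¹ - 1)) - 1 := by
      have e : ∀ κ ∈ K.powerset, p ^ κ.card * (1 - p) ^ (K.card - κ.card) * (g κ - 1) ^ 2 =
          p ^ κ.card * (1 - p) ^ (K.card - κ.card) * g κ ^ 2 -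
            2 * (p ^ κ.card * (1 - p) ^ (K.card - κ.card) * g κ) +
            p ^ κ.card * (1 - p) ^ (K.card - κ.card) := fun κ _ => by ring
      rw [Finset.sum_congr rfl e, Finset.sum_add_distrib, Finset.sum_sub_distrib,
        ← Finset.mul_sum, h9', h8', sum_pw_eq_one]
      ring
    rw [hvar] at hcs
    exact hcs
  have h3 := Real.abs_le_sqrt h2
  rw [abs_of_nonneg (Finset.sum_nonneg fun κ hκ => mul_nonneg (hpw κ hκ) (abs_nonneg _))] at h3
  exact h1.trans h3

end StubCollar

/-- **Registered form of the abstract CCFS / AKN window** (`StubCollar.tv_window` at universe `0`):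
the total-variation distance between a finite product Bernoulli(`p`) law and its template sprinkling of
density `s` over pairwise disjoint blocks is at most `√(∏_k (1 + s²(p^{−|U k|} − 1)) − 1)`.
[cite: ChayesEtAl1986, finite-size scaling window] -/
theorem stub_collar_chisq : ∀ {α β : Type} [DecidableEq α] [DecidableEq β] (K : Finset α) (I : Finset β) (U : β → Finset α), (↑I : Set β).PairwiseDisjoint U → (∀ k ∈ I, U k ⊆ K) → ∀ (p : ℝ), 0 < p → p ≤ 1 → ∀ (s : ℝ) (F : Finset α → ℝ), (∀ κ, |F κ| ≤ 1) → |∑ κ ∈ K.powerset, p ^ κ.card * (1 - p) ^ (K.card - κ.card) * F κ - ∑ J ∈ I.powerset, s ^ J.card * (1 - s) ^ (I.card - J.card) * ∑ κ ∈ K.powerset, p ^ κ.card * (1 - p) ^ (K.card - κ.card) * F (κ ∪ J.biUnion U)| ≤ Real.sqrt (∏ k ∈ I, (1 + s ^ 2 * ((p ^ (U k).card)⁻¹ - 1)) - 1) :=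
  fun K I U hU hUK p hp0 hp1 s F hF => StubCollar.tv_window K I U hU hUK p hp0 hp1 s F hF

end Summit.CriticalPhenomena.PercolationContinuityZ3.Theorems.FreeBoxSparse
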